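import Literature.NumberTheory.DiophantineGeometry.SimplestQuarticThueSmallSolutions
import Literature.NumberTheory.DiophantineGeometry.SimplestQuarticThueApproximationConstants

/-!
# The simplest quartic Thue equations: the endgame of [ChenVoutier1997, §3.2] — Thm 3 from Thm 5

Proved companions of the named fact `SimplestQuarticThueSolutions` ([ChenVoutier1997, Thm 3]).  This
file formalises the last page of [ChenVoutier1997, §3.2] ("Now we can turn to the 'large' solutions"):
**conditionally on the irrationality measure of [ChenVoutier1997, Thm 5]** — taken as an explicit
hypothesis, for the three roots `β⁽⁰⁾, β⁽¹⁾, β⁽³⁾` with the printed constant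
`c₀ = c₁ = c₃ = 11.33 t · 0.4^κ` and range `|q| > 0.16 t` — the equation `P_t(x, y) = ±1`, `t ≥ 128`,
has no solution with `5|y| ≥ t` (`no_large_solution_of_measure`): for the smallest `δ⁽ʲ⁾` one has
`δ⁽ʲ⁾ ≤ 1/∏_{i≠j} δ⁽ⁱ⁾ ≤ 1/((19/20)³ t |y|³)` (resp. `1/((19/20)³ t³ |y|³)` for `j = 2`) by (3.17)–(3.18),
against `δ⁽ʲ⁾ > 1/(c|y|^κ)` (for `j = 2`: the measure of `β⁽⁰⁾ = −1/β⁽²⁾` at `(p, q) = (−y, x)` — the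
printed `j = 2` bookkeeping via `c₂` is replaced by this, which needs no separate constant), whence
`(19/20)³ |y|³ < 11.33 · 0.4^κ |y|^κ` up to a factor `(t/(t+1))³`, impossible for `|y| ≥ 25`, `κ < 3`
(`25³ · 0.8 > 11.33 · 10^κ`; `final_numeric`).  Together with the unconditional parts already in the
tree (`simplestQuarticThueSolutions_of_large`: `min(|x|,|y|) ≤ 1` and `2 ≤ |·| ≤ (t−1)/5` settled) this
gives the reduction of the fact to exactly its two published inputs (`simplestQuarticThueSolutions_of`):
[ChenVoutier1997, Thm 5] for `t ≥ 128` (with `κ = log(8ε)/log(ε/8) ∈ (1, 3)`,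
`SimplestQuarticThue.kappa_lt_three`) and the classification of the large solutions for
`1 ≤ t ≤ 127` ([LettlPetho1995], linear forms in two logarithms).

## References

* Chen Jian Hua, P. M. Voutier, J. Number Theory 62 (1997) 71–99 = arXiv:1401.5450, Thm 5 and §3.2
  (pp. 7–8 of the arXiv version). [ChenVoutier1997]
* G. Lettl, A. Pethő, Abh. Math. Sem. Univ. Hamburg 65 (1995) 365–383. [LettlPetho1995]
-/

noncomputable section

namespace Literature.NumberTheory.DiophantineGeometry

namespace SimplestQuarticThue

open Real

/-! ## The final numerical contradiction -/

/-- `K Y³ < 11.33 · 0.4^κ · Y^κ` is impossible for `Y ≥ 25`, `0 < κ < 3`, `K ≥ 4/5`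
(as `K · 25³ ≥ 12500 > 11330 > 11.33 · 10^κ`). [cite: ChenVoutier1997, §3.2 (p. 8)] -/
theorem final_numeric {Y κ K : ℝ} (hY : 25 ≤ Y) (hκ : κ < 3) (hK : 4 / 5 ≤ K)
    (h : K * Y ^ 3 < 1133 / 100 * (2 / 5 : ℝ) ^ κ * Y ^ κ) : False := by
  have hY0 : 0 < Y := by linarith
  have hYκ : 0 < Y ^ κ := Real.rpow_pos_of_pos hY0 κ
  -- `Y³ = Y^κ · Y^(3-κ)` and `Y^(3-κ) ≥ 25^(3-κ)`
  have h3 : Y ^ 3 = Y ^ κ * Y ^ (3 - κ) := by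
    rw [← Real.rpow_natCast Y 3, ← Real.rpow_add hY0]; norm_num
  have h25 : (25 : ℝ) ^ (3 - κ) ≤ Y ^ (3 - κ) := Real.rpow_le_rpow (by norm_num) hY (by linarith)
  have h25pos : 0 < (25 : ℝ) ^ (3 - κ) := Real.rpow_pos_of_pos (by norm_num) _
  -- hence `K · 25^(3-κ) < 11.33 · 0.4^κ`
  have h1 : K * (25 : ℝ) ^ (3 - κ) < 1133 / 100 * (2 / 5 : ℝ) ^ κ := by
    have hK0 : 0 ≤ K := by linarith
    have : K * (25 : ℝ) ^ (3 - κ) * Y ^ κ ≤ K * Y ^ 3 := by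
      rw [h3]; nlinarith [mul_le_mul_of_nonneg_left h25 hK0]
    nlinarith
  -- multiply by `25^κ`: `K · 25³ < 11.33 · 10^κ < 11330`
  have h2 : (25 : ℝ) ^ (3 - κ) * (25 : ℝ) ^ κ = 15625 := by
    rw [← Real.rpow_add (by norm_num)]; norm_num
  have h4 : (2 / 5 : ℝ) ^ κ * (25 : ℝ) ^ κ = 10 ^ κ := by
    rw [← Real.mul_rpow (by norm_num) (by norm_num)]; norm_num
  have h5 : (10 : ℝ) ^ κ < 1000 := by
    calc (10 : ℝ) ^ κ < 10 ^ (3 : ℝ) := Real.rpow_lt_rpow_of_exponent_lt (by norm_num) hκ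
      _ = 1000 := by norm_num
  have h6 : 0 < (25 : ℝ) ^ κ := Real.rpow_pos_of_pos (by norm_num) _
  have h7 : K * (25 : ℝ) ^ (3 - κ) * (25 : ℝ) ^ κ < 1133 / 100 * (2 / 5 : ℝ) ^ κ * (25 : ℝ) ^ κ :=
    mul_lt_mul_of_pos_right h1 h6
  rw [mul_assoc, h2, mul_assoc, h4] at h7
  nlinarith

/-! ## The four cases of the endgame (which `δ⁽ʲ⁾` is smallest), `t ≥ 128`, `5y ≥ t` -/

/-- Common step for `j = 0, 1, 3`: from `δⱼ ≤ 1/((19/20 y)(19/20 y)(19/20 · t · y))` and the measure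
`δⱼ > 1/(c y^κ)`, `c = 11.33 t 0.4^κ`: contradiction. [cite: ChenVoutier1997, §3.2 (p. 8)] -/
theorem endgame_of_bounds {t Y κ δ : ℝ} (ht : 128 ≤ t) (hY : 25 ≤ Y) (hκ : κ < 3)
    (hup : δ ≤ 1 / (19 / 20 * Y * (19 / 20 * Y) * (19 / 20 * t * Y)))
    (hlow : 1 / (1133 / 100 * t * (2 / 5 : ℝ) ^ κ * Y ^ κ) < δ) : False := by
  have ht0 : 0 < t := by linarith
  have hY0 : 0 < Y := by linarith
  have hYκ : 0 < Y ^ κ := Real.rpow_pos_of_pos hY0 κ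
  have h04 : 0 < (2 / 5 : ℝ) ^ κ := Real.rpow_pos_of_pos (by norm_num) κ
  have key := hlow.trans_le hup
  rw [one_div_lt_one_div (by positivity) (by positivity)] at key
  -- `(19/20)³ t Y³ < 11.33 t 0.4^κ Y^κ`
  refine final_numeric hY hκ (K := (19 / 20) ^ 3) (by norm_num) ?_
  have : (19 / 20 : ℝ) ^ 3 * Y ^ 3 * t < 1133 / 100 * (2 / 5 : ℝ) ^ κ * Y ^ κ * t := by nlinarith
  exact lt_of_mul_lt_mul_right this ht0.le

variable {t x y : ℤ} {β0 β1 β2 β3 κ : ℝ}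

/-- Case `δ⁽⁰⁾` smallest. [cite: ChenVoutier1997, §3.2 (p. 8, `δ⁽⁰⁾`)] -/
theorem large_case_zero (ht : (128 : ℝ) ≤ t) (hy : (25 : ℝ) ≤ y) (hκ : κ < 3)
    (h0lo : -(1 / (t : ℝ)) < β0) (h0hi : β0 < -(1 / ((t : ℝ) + 1)))
    (h1lo : 1 - 2 / (t : ℝ) < β1) (h2lo : (t : ℝ) < β2)
    (h3hi : β3 < -1 - 2 * t / ((t : ℝ) ^ 2 + 4))
    (hprod : |(x : ℝ) - β0 * y| * |(x : ℝ) - β1 * y| * |(x : ℝ) - β2 * y| * |(x : ℝ) - β3 * y| = 1)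
    (hmin : |(x : ℝ) - β0 * y| ≤ |(x : ℝ) - β1 * y| ∧ |(x : ℝ) - β0 * y| ≤ |(x : ℝ) - β2 * y| ∧
      |(x : ℝ) - β0 * y| ≤ |(x : ℝ) - β3 * y|)
    (hmeas : 1 / (1133 / 100 * t * (2 / 5 : ℝ) ^ κ * (y : ℝ) ^ κ) < |(x : ℝ) - β0 * y|) : False := by
  have hT0 : (0 : ℝ) < t := by linarith
  have hi1 : (0 : ℝ) < 1 / ((t : ℝ) + 1) := by positivity
  obtain ⟨h01, h02, h03⟩ := hmin
  set δ0 := |(x : ℝ) - β0 * y| with hδ0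
  set δ1 := |(x : ℝ) - β1 * y| with hδ1
  set δ2 := |(x : ℝ) - β2 * y| with hδ2
  set δ3 := |(x : ℝ) - β3 * y| with hδ3
  have hle1 : δ0 ≤ 1 := le_one_of_prod_eq_one hprod (abs_nonneg _) h01 h02 h03
  have hYabs : |(y : ℝ)| = y := abs_of_nonneg (by linarith)
  have hA : 1 / (t : ℝ) ≤ 2 * t / ((t : ℝ) ^ 2 + 4) := by
    rw [div_le_div_iff₀ hT0 (by positivity)]; nlinarith
  -- separations
  have hs01 : (99 : ℝ) / 100 ≤ β1 - β0 := by
    have h1 : (99 : ℝ) / 100 ≤ 1 - 2 / (t : ℝ) + 1 / ((t : ℝ) + 1) := by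
      rw [show 1 - 2 / (t : ℝ) + 1 / ((t : ℝ) + 1) = ((t : ℝ) ^ 2 - 2) / (t * (t + 1)) by
        field_simp; ring]
      rw [div_le_div_iff₀ (by norm_num) (by positivity)]
      nlinarith [mul_nonneg (by linarith : (0 : ℝ) ≤ (t : ℝ) - 101) (by positivity : (0 : ℝ) ≤ (t : ℝ))]
    linarith
  have hs02 : (t : ℝ) ≤ β2 - β0 := by linarith
  have hs03 : (1 : ℝ) ≤ β0 - β3 := by linarith
  have hL1 : 19 / 20 * (y : ℝ) ≤ δ1 := by
    have h1 := abs_sub_mul_ge (x : ℝ) (y : ℝ) β1 β0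
    rw [hYabs, abs_of_nonneg (by linarith : (0 : ℝ) ≤ β1 - β0)] at h1
    have h2 : (99 : ℝ) / 100 * y ≤ (β1 - β0) * y := mul_le_mul_of_nonneg_right hs01 (by linarith)
    linarith
  have hL2 : 19 / 20 * (t : ℝ) * y ≤ δ2 := by
    have h1 := abs_sub_mul_ge (x : ℝ) (y : ℝ) β2 β0
    rw [hYabs, abs_of_nonneg (by linarith : (0 : ℝ) ≤ β2 - β0)] at h1
    have h2 : (t : ℝ) * y ≤ (β2 - β0) * y := mul_le_mul_of_nonneg_right hs02 (by linarith)
    nlinarith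
  have hL3 : 19 / 20 * (y : ℝ) ≤ δ3 := by
    have h1 := abs_sub_mul_ge (x : ℝ) (y : ℝ) β3 β0
    rw [hYabs, abs_sub_comm, abs_of_nonneg (by linarith : (0 : ℝ) ≤ β0 - β3)] at h1
    have h2 : (1 : ℝ) * y ≤ (β0 - β3) * y := mul_le_mul_of_nonneg_right hs03 (by linarith)
    linarith
  have hup : δ0 ≤ 1 / (19 / 20 * (y : ℝ) * (19 / 20 * (y : ℝ)) * (19 / 20 * (t : ℝ) * y)) :=
    le_one_div_of_prod_eq_one (by rw [← hprod]; ring) (abs_nonneg _) (by positivity) (by positivity)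
      (by positivity) hL1 hL3 hL2
  exact endgame_of_bounds ht hy hκ hup hmeas

/-- Case `δ⁽¹⁾` smallest. [cite: ChenVoutier1997, §3.2 (p. 8, `δ⁽¹⁾`)] -/
theorem large_case_one (ht : (128 : ℝ) ≤ t) (hy : (25 : ℝ) ≤ y) (hκ : κ < 3)
    (h0hi : β0 < -(1 / ((t : ℝ) + 1))) (h1lo : 1 - 2 / (t : ℝ) < β1) (h1hi : β1 < 1)
    (h2lo : (t : ℝ) < β2) (h3hi : β3 < -1)
    (hprod : |(x : ℝ) - β0 * y| * |(x : ℝ) - β1 * y| * |(x : ℝ) - β2 * y| * |(x : ℝ) - β3 * y| = 1)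
    (hmin : |(x : ℝ) - β1 * y| ≤ |(x : ℝ) - β0 * y| ∧ |(x : ℝ) - β1 * y| ≤ |(x : ℝ) - β2 * y| ∧
      |(x : ℝ) - β1 * y| ≤ |(x : ℝ) - β3 * y|)
    (hmeas : 1 / (1133 / 100 * t * (2 / 5 : ℝ) ^ κ * (y : ℝ) ^ κ) < |(x : ℝ) - β1 * y|) : False := by
  have hT0 : (0 : ℝ) < t := by linarith
  have hi1 : (0 : ℝ) < 1 / ((t : ℝ) + 1) := by positivity
  obtain ⟨h10, h12, h13⟩ := hmin
  set δ0 := |(x : ℝ) - β0 * y| with hδ0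
  set δ1 := |(x : ℝ) - β1 * y| with hδ1
  set δ2 := |(x : ℝ) - β2 * y| with hδ2
  set δ3 := |(x : ℝ) - β3 * y| with hδ3
  have hle1 : δ1 ≤ 1 :=
    le_one_of_prod_eq_one (by rw [← hprod]; ring) (abs_nonneg _) h10 h12 h13
  have hYabs : |(y : ℝ)| = y := abs_of_nonneg (by linarith)
  have hs10 : (99 : ℝ) / 100 ≤ β1 - β0 := by
    have h1 : (99 : ℝ) / 100 ≤ 1 - 2 / (t : ℝ) + 1 / ((t : ℝ) + 1) := by
      rw [show 1 - 2 / (t : ℝ) + 1 / ((t : ℝ) + 1) = ((t : ℝ) ^ 2 - 2) / (t * (t + 1)) by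
        field_simp; ring]
      rw [div_le_div_iff₀ (by norm_num) (by positivity)]
      nlinarith [mul_nonneg (by linarith : (0 : ℝ) ≤ (t : ℝ) - 101) (by positivity : (0 : ℝ) ≤ (t : ℝ))]
    linarith
  have h2t : 2 / (t : ℝ) ≤ 2 / 128 := div_le_div_of_nonneg_left (by norm_num) (by norm_num) ht
  have hL0 : 19 / 20 * (y : ℝ) ≤ δ0 := by
    have h1 := abs_sub_mul_ge (x : ℝ) (y : ℝ) β0 β1
    rw [hYabs, abs_sub_comm, abs_of_nonneg (by linarith : (0 : ℝ) ≤ β1 - β0)] at h1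
    have h2 : (99 : ℝ) / 100 * y ≤ (β1 - β0) * y := mul_le_mul_of_nonneg_right hs10 (by linarith)
    linarith
  have hL2 : 19 / 20 * (t : ℝ) * y ≤ δ2 := by
    have h1 := abs_sub_mul_ge (x : ℝ) (y : ℝ) β2 β1
    rw [hYabs, abs_of_nonneg (by linarith : (0 : ℝ) ≤ β2 - β1)] at h1
    have h2 : ((t : ℝ) - 1) * y ≤ (β2 - β1) * y := mul_le_mul_of_nonneg_right (by linarith) (by linarith)
    nlinarith
  have hL3 : 19 / 20 * (y : ℝ) ≤ δ3 := by
    have h1 := abs_sub_mul_ge (x : ℝ) (y : ℝ) β3 β1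
    rw [hYabs, abs_sub_comm, abs_of_nonneg (by linarith : (0 : ℝ) ≤ β1 - β3)] at h1
    have h2 : (2 - 2 / (t : ℝ)) * y ≤ (β1 - β3) * y :=
      mul_le_mul_of_nonneg_right (by linarith) (by linarith)
    nlinarith
  have hup : δ1 ≤ 1 / (19 / 20 * (y : ℝ) * (19 / 20 * (y : ℝ)) * (19 / 20 * (t : ℝ) * y)) :=
    le_one_div_of_prod_eq_one (by rw [← hprod]; ring) (abs_nonneg _) (by positivity) (by positivity)
      (by positivity) hL0 hL3 hL2
  exact endgame_of_bounds ht hy hκ hup hmeas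

/-- Case `δ⁽³⁾` smallest. [cite: ChenVoutier1997, §3.2 (p. 8, `δ⁽³⁾`)] -/
theorem large_case_three (ht : (128 : ℝ) ≤ t) (hy : (25 : ℝ) ≤ y) (hκ : κ < 3)
    (h0lo : -(1 / (t : ℝ)) < β0) (h1lo : 1 - 2 / (t : ℝ) < β1) (h2lo : (t : ℝ) < β2)
    (h3hi : β3 < -1 - 2 * t / ((t : ℝ) ^ 2 + 4))
    (hprod : |(x : ℝ) - β0 * y| * |(x : ℝ) - β1 * y| * |(x : ℝ) - β2 * y| * |(x : ℝ) - β3 * y| = 1)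
    (hmin : |(x : ℝ) - β3 * y| ≤ |(x : ℝ) - β0 * y| ∧ |(x : ℝ) - β3 * y| ≤ |(x : ℝ) - β1 * y| ∧
      |(x : ℝ) - β3 * y| ≤ |(x : ℝ) - β2 * y|)
    (hmeas : 1 / (1133 / 100 * t * (2 / 5 : ℝ) ^ κ * (y : ℝ) ^ κ) < |(x : ℝ) - β3 * y|) : False := by
  have hT0 : (0 : ℝ) < t := by linarith
  obtain ⟨h30, h31, h32⟩ := hmin
  set δ0 := |(x : ℝ) - β0 * y| with hδ0
  set δ1 := |(x : ℝ) - β1 * y| with hδ1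
  set δ2 := |(x : ℝ) - β2 * y| with hδ2
  set δ3 := |(x : ℝ) - β3 * y| with hδ3
  have hle1 : δ3 ≤ 1 :=
    le_one_of_prod_eq_one (by rw [← hprod]; ring) (abs_nonneg _) h30 h31 h32
  have hYabs : |(y : ℝ)| = y := abs_of_nonneg (by linarith)
  have hA : 1 / (t : ℝ) ≤ 2 * t / ((t : ℝ) ^ 2 + 4) := by
    rw [div_le_div_iff₀ hT0 (by positivity)]; nlinarith
  have hA0 : (0 : ℝ) < 2 * t / ((t : ℝ) ^ 2 + 4) := by positivity
  have h2t : 2 / (t : ℝ) ≤ 2 / 128 := div_le_div_of_nonneg_left (by norm_num) (by norm_num) ht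
  have hL0 : 19 / 20 * (y : ℝ) ≤ δ0 := by
    have h1 := abs_sub_mul_ge (x : ℝ) (y : ℝ) β0 β3
    rw [hYabs, abs_of_nonneg (by linarith : (0 : ℝ) ≤ β0 - β3)] at h1
    have h2 : (1 : ℝ) * y ≤ (β0 - β3) * y := mul_le_mul_of_nonneg_right (by linarith) (by linarith)
    linarith
  have hL1 : 19 / 20 * (y : ℝ) ≤ δ1 := by
    have h1 := abs_sub_mul_ge (x : ℝ) (y : ℝ) β1 β3
    rw [hYabs, abs_of_nonneg (by linarith : (0 : ℝ) ≤ β1 - β3)] at h1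
    have h2 : (2 - 2 / (t : ℝ)) * y ≤ (β1 - β3) * y :=
      mul_le_mul_of_nonneg_right (by linarith) (by linarith)
    nlinarith
  have hL2 : 19 / 20 * (t : ℝ) * y ≤ δ2 := by
    have h1 := abs_sub_mul_ge (x : ℝ) (y : ℝ) β2 β3
    rw [hYabs, abs_of_nonneg (by linarith : (0 : ℝ) ≤ β2 - β3)] at h1
    have h2 : ((t : ℝ) + 1) * y ≤ (β2 - β3) * y := mul_le_mul_of_nonneg_right (by linarith) (by linarith)
    nlinarith
  have hup : δ3 ≤ 1 / (19 / 20 * (y : ℝ) * (19 / 20 * (y : ℝ)) * (19 / 20 * (t : ℝ) * y)) :=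
    le_one_div_of_prod_eq_one (by rw [← hprod]; ring) (abs_nonneg _) (by positivity) (by positivity)
      (by positivity) hL0 hL1 hL2
  exact endgame_of_bounds ht hy hκ hup hmeas

/-- Case `δ⁽²⁾` smallest, step 1: `δ⁽²⁾ ≤ 1/((19/20) t y)³`. [cite: ChenVoutier1997, §3.2 (p. 8, `δ⁽²⁾`)] -/
theorem large_case_two_upper (ht : (128 : ℝ) ≤ t) (hy : (25 : ℝ) ≤ y) (h0hi : β0 < 0)
    (h1hi : β1 < 1) (h2lo : (t : ℝ) < β2) (h3hi : β3 < -1)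
    (hprod : |(x : ℝ) - β0 * y| * |(x : ℝ) - β1 * y| * |(x : ℝ) - β2 * y| * |(x : ℝ) - β3 * y| = 1)
    (hmin : |(x : ℝ) - β2 * y| ≤ |(x : ℝ) - β0 * y| ∧ |(x : ℝ) - β2 * y| ≤ |(x : ℝ) - β1 * y| ∧
      |(x : ℝ) - β2 * y| ≤ |(x : ℝ) - β3 * y|) :
    |(x : ℝ) - β2 * y| ≤ 1 ∧
      |(x : ℝ) - β2 * y| ≤
        1 / (19 / 20 * (t : ℝ) * y * (19 / 20 * (t : ℝ) * y) * (19 / 20 * (t : ℝ) * y)) := by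
  have hT0 : (0 : ℝ) < t := by linarith
  obtain ⟨h20, h21, h23⟩ := hmin
  set δ0 := |(x : ℝ) - β0 * y| with hδ0
  set δ1 := |(x : ℝ) - β1 * y| with hδ1
  set δ2 := |(x : ℝ) - β2 * y| with hδ2
  set δ3 := |(x : ℝ) - β3 * y| with hδ3
  have hle1 : δ2 ≤ 1 :=
    le_one_of_prod_eq_one (by rw [← hprod]; ring) (abs_nonneg _) h20 h21 h23
  have hYabs : |(y : ℝ)| = y := abs_of_nonneg (by linarith)
  have hL0 : 19 / 20 * (t : ℝ) * y ≤ δ0 := by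
    have h1 := abs_sub_mul_ge (x : ℝ) (y : ℝ) β0 β2
    rw [hYabs, abs_sub_comm, abs_of_nonneg (by linarith : (0 : ℝ) ≤ β2 - β0)] at h1
    have h2 : (t : ℝ) * y ≤ (β2 - β0) * y := mul_le_mul_of_nonneg_right (by linarith) (by linarith)
    nlinarith
  have hL1 : 19 / 20 * (t : ℝ) * y ≤ δ1 := by
    have h1 := abs_sub_mul_ge (x : ℝ) (y : ℝ) β1 β2
    rw [hYabs, abs_sub_comm, abs_of_nonneg (by linarith : (0 : ℝ) ≤ β2 - β1)] at h1
    have h2 : ((t : ℝ) - 1) * y ≤ (β2 - β1) * y := mul_le_mul_of_nonneg_right (by linarith) (by linarith)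
    nlinarith
  have hL3 : 19 / 20 * (t : ℝ) * y ≤ δ3 := by
    have h1 := abs_sub_mul_ge (x : ℝ) (y : ℝ) β3 β2
    rw [hYabs, abs_sub_comm, abs_of_nonneg (by linarith : (0 : ℝ) ≤ β2 - β3)] at h1
    have h2 : ((t : ℝ) + 1) * y ≤ (β2 - β3) * y := mul_le_mul_of_nonneg_right (by linarith) (by linarith)
    nlinarith
  exact ⟨hle1, le_one_div_of_prod_eq_one (by rw [← hprod]; ring) (abs_nonneg _) (by positivity)
    (by positivity) (by positivity) hL0 hL1 hL3⟩

/-- Case `δ⁽²⁾` smallest, step 2: the size of `x`, `0 < x`, `0.16 t < |x| ≤ (t + 1) y`.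
[cite: ChenVoutier1997, §3.2 (p. 8, `δ⁽²⁾`)] -/
theorem large_case_two_abs_x (ht : (128 : ℝ) ≤ t) (hy : (25 : ℝ) ≤ y) (h2lo : (t : ℝ) < β2)
    (h2hi : β2 < t + 5 / (t : ℝ)) (hδ : |(x : ℝ) - β2 * y| ≤ 1) :
    0 < (x : ℝ) ∧ (4 / 25 : ℝ) * t < |(x : ℝ)| ∧ |(x : ℝ)| ≤ ((t : ℝ) + 1) * y := by
  have hT0 : (0 : ℝ) < t := by linarith
  obtain ⟨hx1, hx2⟩ := abs_le.1 hδ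
  have hty : (128 : ℝ) * 25 ≤ (t : ℝ) * y := mul_le_mul ht hy (by norm_num) hT0.le
  have h2 : (t : ℝ) * y ≤ β2 * y := mul_le_mul_of_nonneg_right h2lo.le (by linarith)
  have hxpos : 0 < (x : ℝ) := by linarith
  refine ⟨hxpos, ?_, ?_⟩
  · rw [abs_of_pos hxpos]; nlinarith
  · rw [abs_of_pos hxpos]
    have h3 : β2 * (y : ℝ) ≤ ((t : ℝ) + 5 / t) * y := mul_le_mul_of_nonneg_right h2hi.le (by linarith)
    have h4 : 5 / (t : ℝ) ≤ 5 / 128 := div_le_div_of_nonneg_left (by norm_num) (by norm_num) ht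
    have h5 : 5 / (t : ℝ) * y ≤ 5 / 128 * y := mul_le_mul_of_nonneg_right h4 (by linarith)
    nlinarith

/-- Case `δ⁽²⁾` smallest, step 3: the measure of `β⁽⁰⁾` at `(p, q) = (−y, x)` against the upper bound.
[cite: ChenVoutier1997, §3.2 (p. 8, `δ⁽²⁾`)] -/
theorem large_case_two_numeric {X Y δ : ℝ} (ht : (128 : ℝ) ≤ t) (hy : 25 ≤ Y) (hκ0 : 0 < κ)
    (hκ : κ < 3) (hX0 : 0 < X) (hX : X ≤ ((t : ℝ) + 1) * Y) (h0lo : -(1 / (t : ℝ)) < β0)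
    (hδ0 : 0 ≤ δ)
    (hup : δ ≤ 1 / (19 / 20 * (t : ℝ) * Y * (19 / 20 * (t : ℝ) * Y) * (19 / 20 * (t : ℝ) * Y)))
    (hm : 1 / (1133 / 100 * t * (2 / 5 : ℝ) ^ κ * X ^ κ) < -β0 * δ) : False := by
  have hT0 : (0 : ℝ) < t := by linarith
  have hY0 : (0 : ℝ) < Y := by linarith
  have hδt : -β0 * δ ≤ 1 / (t : ℝ) * δ := mul_le_mul_of_nonneg_right (by linarith) hδ0
  -- `X^κ ≤ ((t+1) Y)^κ ≤ (t+1)³ Y^κ`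
  have hXκ : X ^ κ ≤ ((t : ℝ) + 1) ^ 3 * Y ^ κ := by
    calc X ^ κ ≤ (((t : ℝ) + 1) * Y) ^ κ := Real.rpow_le_rpow hX0.le hX hκ0.le
      _ = ((t : ℝ) + 1) ^ κ * Y ^ κ := Real.mul_rpow (by linarith) hY0.le
      _ ≤ ((t : ℝ) + 1) ^ (3 : ℝ) * Y ^ κ := by
          apply mul_le_mul_of_nonneg_right _ (Real.rpow_nonneg hY0.le κ)
          exact Real.rpow_le_rpow_of_exponent_le (by linarith) hκ.le
      _ = ((t : ℝ) + 1) ^ 3 * Y ^ κ := by norm_num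
  have h04 : 0 < (2 / 5 : ℝ) ^ κ := Real.rpow_pos_of_pos (by norm_num) κ
  have hYκ : 0 < Y ^ κ := Real.rpow_pos_of_pos hY0 κ
  have hXκ0 : 0 < X ^ κ := Real.rpow_pos_of_pos hX0 κ
  have hlow : 1 / (1133 / 100 * t * (2 / 5 : ℝ) ^ κ * (((t : ℝ) + 1) ^ 3 * Y ^ κ)) <
      1 / (t : ℝ) * δ := by
    refine lt_of_le_of_lt ?_ (hm.trans_le hδt)
    apply one_div_le_one_div_of_le (by positivity)
    exact mul_le_mul_of_nonneg_left hXκ (by positivity)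
  have hup' : 1 / (t : ℝ) * δ ≤ 1 / (t : ℝ) *
      (1 / (19 / 20 * (t : ℝ) * Y * (19 / 20 * (t : ℝ) * Y) * (19 / 20 * (t : ℝ) * Y))) :=
    mul_le_mul_of_nonneg_left hup (by positivity)
  have key := hlow.trans_le hup'
  rw [one_div_mul_one_div] at key
  have hP : (0 : ℝ) < (t : ℝ) * (19 / 20 * (t : ℝ) * Y * (19 / 20 * (t : ℝ) * Y) * (19 / 20 * (t : ℝ) * Y)) := by
    positivity
  have hQ : (0 : ℝ) < 1133 / 100 * t * (2 / 5 : ℝ) ^ κ * (((t : ℝ) + 1) ^ 3 * Y ^ κ) := by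
    positivity
  rw [one_div_lt_one_div hQ hP] at key
  -- divide by `t (t + 1)³`
  set K : ℝ := (19 / 20 : ℝ) ^ 3 * ((t : ℝ) / ((t : ℝ) + 1)) ^ 3 with hK_def
  have hK : 4 / 5 ≤ K := by
    have hr : (128 : ℝ) / 129 ≤ (t : ℝ) / ((t : ℝ) + 1) := by
      rw [div_le_div_iff₀ (by norm_num) (by positivity)]; linarith
    have hr3 : ((128 : ℝ) / 129) ^ 3 ≤ ((t : ℝ) / ((t : ℝ) + 1)) ^ 3 :=
      pow_le_pow_left₀ (by norm_num) hr 3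
    rw [hK_def]; nlinarith
  refine final_numeric hy hκ hK ?_
  have e1 : K * Y ^ 3 * ((t : ℝ) * ((t : ℝ) + 1) ^ 3) =
      (t : ℝ) * (19 / 20 * (t : ℝ) * Y * (19 / 20 * (t : ℝ) * Y) * (19 / 20 * (t : ℝ) * Y)) := by
    rw [hK_def]; field_simp
  have e2 : 1133 / 100 * (2 / 5 : ℝ) ^ κ * Y ^ κ * ((t : ℝ) * ((t : ℝ) + 1) ^ 3) =
      1133 / 100 * t * (2 / 5 : ℝ) ^ κ * (((t : ℝ) + 1) ^ 3 * Y ^ κ) := by ring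
  refine lt_of_mul_lt_mul_right ?_ (by positivity : (0 : ℝ) ≤ (t : ℝ) * ((t : ℝ) + 1) ^ 3)
  rw [e1, e2]
  exact key

/-- Case `δ⁽²⁾` smallest: here the measure of `β⁽⁰⁾ = −1/β⁽²⁾` is applied to `(p, q) = (−y, x)`,
`|x| ≈ t|y|`, using `|β⁽⁰⁾x + y| = |β⁽⁰⁾| δ⁽²⁾ ≤ δ⁽²⁾/t` and `|x| ≤ (t + 1)|y|` (so no constant `c₂` is
needed). [cite: ChenVoutier1997, §3.2 (p. 8, `δ⁽²⁾`)] -/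
theorem large_case_two (ht : (128 : ℝ) ≤ t) (hy : (25 : ℝ) ≤ y) (hκ0 : 0 < κ) (hκ : κ < 3)
    (h0lo : -(1 / (t : ℝ)) < β0) (h0hi : β0 < 0) (h02 : β0 * β2 = -1)
    (h1hi : β1 < 1) (h2lo : (t : ℝ) < β2) (h2hi : β2 < t + 5 / (t : ℝ)) (h3hi : β3 < -1)
    (hprod : |(x : ℝ) - β0 * y| * |(x : ℝ) - β1 * y| * |(x : ℝ) - β2 * y| * |(x : ℝ) - β3 * y| = 1)
    (hmin : |(x : ℝ) - β2 * y| ≤ |(x : ℝ) - β0 * y| ∧ |(x : ℝ) - β2 * y| ≤ |(x : ℝ) - β1 * y| ∧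
      |(x : ℝ) - β2 * y| ≤ |(x : ℝ) - β3 * y|)
    (hmeas : (4 / 25 : ℝ) * t < |(x : ℝ)| →
      1 / (1133 / 100 * t * (2 / 5 : ℝ) ^ κ * |(x : ℝ)| ^ κ) < |((-y : ℤ) : ℝ) - β0 * x|) : False := by
  obtain ⟨hle1, hup⟩ := large_case_two_upper ht hy h0hi h1hi h2lo h3hi hprod hmin
  obtain ⟨hxpos, hxN, hxhi⟩ := large_case_two_abs_x ht hy h2lo h2hi hle1
  have hm := hmeas hxN
  have hrel : |((-y : ℤ) : ℝ) - β0 * x| = -β0 * |(x : ℝ) - β2 * y| := by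
    have e : ((-y : ℤ) : ℝ) - β0 * x = -β0 * ((x : ℝ) - β2 * y) := by
      push_cast
      have : β0 * β2 * (y : ℝ) = -(y : ℝ) := by rw [h02]; ring
      linear_combination -this
    rw [e, abs_mul, abs_of_pos (by linarith : (0 : ℝ) < -β0)]
  rw [hrel] at hm
  exact large_case_two_numeric ht hy hκ0 hκ (abs_pos.2 hxpos.ne') hxhi h0lo (abs_nonneg _) hup hm

/-! ## Thm 3 for `t ≥ 128` from Thm 5, and the reduction of the fact to its two published inputs -/

/-- **No large solutions for `t ≥ 128`, conditionally on [ChenVoutier1997, Thm 5].**  If the three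
roots `β⁽⁰⁾ = ε − ρ`, `β⁽¹⁾ = (ρ − 1)/ε`, `β⁽³⁾ = −(ρ + 1)/ε` of `P_t(X, 1)` satisfy the irrationality
measure printed in Thm 5 — `|p − βq| > 1/(c|q|^κ)` for all integers `p, q` with `|q| > 0.16t`, where
`c = 11.33 t · 0.4^κ` — for some exponent `0 < κ < 3`, then `P_t(x, y) = ±1` has no solution with
`5|y| ≥ t`. [cite: ChenVoutier1997, Thm 5 and §3.2 (pp. 7–8)] -/
theorem no_large_solution_of_measure {t : ℤ} (ht : 128 ≤ t) {ε ρ κ : ℝ} (hε : 0 < ε)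
    (h : ε - ε⁻¹ = (t : ℝ) / 2) (hρ : 0 < ρ) (hρ2 : ρ ^ 2 = 1 + ε ^ 2) (hκ0 : 0 < κ) (hκ : κ < 3)
    (H : ∀ β ∈ ({ε - ρ, (ρ - 1) / ε, -(ρ + 1) / ε} : Set ℝ), ∀ p q : ℤ,
      (4 / 25 : ℝ) * t < |(q : ℝ)| →
        1 / (1133 / 100 * t * (2 / 5 : ℝ) ^ κ * |(q : ℝ)| ^ κ) < |(p : ℝ) - β * q|)
    {x y : ℤ} (hy : t ≤ 5 * |y|)
    (hP : simplestQuarticForm t x y = 1 ∨ simplestQuarticForm t x y = -1) : False := by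
  -- reduce to `y > 0`
  wlog hypos : 0 < y generalizing x y
  · have hy0 : y ≠ 0 := by rintro rfl; simp at hy; omega
    refine this (x := -x) (y := -y) (by rwa [abs_neg]) ?_ (by omega)
    rwa [simplestQuarticForm_neg_neg]
  rw [abs_of_pos hypos] at hy
  have hT : (128 : ℝ) ≤ (t : ℝ) := by exact_mod_cast ht
  have hT0 : (0 : ℝ) < t := by linarith
  have hy26 : (25 : ℝ) ≤ (y : ℝ) := by
    have h26 : (26 : ℤ) ≤ y := by omega
    have : (26 : ℝ) ≤ (y : ℝ) := by exact_mod_cast h26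
    linarith
  have hyq : (4 / 25 : ℝ) * t < |(y : ℝ)| := by
    rw [abs_of_pos (by exact_mod_cast hypos)]
    have : (t : ℝ) ≤ 5 * (y : ℝ) := by exact_mod_cast hy
    linarith
  have hYabs : |(y : ℝ)| = y := abs_of_pos (by exact_mod_cast hypos)
  -- roots
  obtain ⟨h2lo, h2hi⟩ := root_two_bounds hε h hT0 hρ hρ2
  obtain ⟨h0lo, h0hi⟩ := root_zero_bounds hε h hT0 hρ hρ2
  obtain ⟨h1lo, h1hi⟩ := root_one_bounds hε h (by linarith) hρ hρ2
  obtain ⟨-, h3hi⟩ := root_three_bounds hε h (by linarith) hρ hρ2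
  have h02 := (root_mul_root hε hρ2).1
  have h0hi' : ε - ρ < -(1 / ((t : ℝ) + 1)) := by
    refine lt_of_lt_of_le h0hi (neg_le_neg ?_)
    apply one_div_le_one_div_of_le (by positivity)
    have : 5 / (t : ℝ) ≤ 1 := by rw [div_le_one hT0]; linarith
    linarith
  have h0neg : ε - ρ < 0 := by
    have : (0 : ℝ) < 1 / ((t : ℝ) + 1) := by positivity
    linarith
  have h3hi' : -(ρ + 1) / ε < -1 := by
    have : (0 : ℝ) < 2 * t / ((t : ℝ) ^ 2 + 4) := by positivity
    linarith
  have hprod := prod_abs_sub_root_mul_eq_one hε h hρ2 hP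
  -- the measures at `q = y`
  have hm0 := H (ε - ρ) (by simp) x y hyq
  have hm1 := H ((ρ - 1) / ε) (by simp) x y hyq
  have hm3 := H (-(ρ + 1) / ε) (by simp) x y hyq
  rw [hYabs] at hm0 hm1 hm3
  rcases min4_cases |(x : ℝ) - (ε - ρ) * y| |(x : ℝ) - (ρ - 1) / ε * y| |(x : ℝ) - (ε + ρ) * y|
      |(x : ℝ) - -(ρ + 1) / ε * y| with hm | hm | hm | hm
  · exact large_case_zero hT hy26 hκ h0lo h0hi' h1lo h2lo h3hi hprod hm hm0
  · exact large_case_one hT hy26 hκ h0hi' h1lo h1hi h2lo h3hi' hprod hm hm1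
  · exact large_case_two hT hy26 hκ0 hκ h0lo h0neg h02 h1hi h2lo h2hi h3hi' hprod hm
      (fun hx => H (ε - ρ) (by simp) (-y) x hx)
  · exact large_case_three hT hy26 hκ h0lo h1lo h2lo h3hi hprod hm hm3

/-- **`SimplestQuarticThueSolutions` from its two published inputs.**  The fact follows from
(1) [ChenVoutier1997, Thm 5] for `t ≥ 128` — the irrationality measure of `β⁽⁰⁾, β⁽¹⁾, β⁽³⁾` with
`κ = log(8ε)/log(ε/8)`, `c = 11.33 t · 0.4^κ`, `|q| > 0.16 t`, stated for `ε = (t + √(t² + 16))/4`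
through its defining relations — and (2) the classification of the large solutions for `1 ≤ t ≤ 127`
([LettlPetho1995]); everything else (`min(|x|,|y|) ≤ 1`; `2 ≤ |·| ≤ (t − 1)/5`; the endgame above;
`1 < κ < 3` for `t ≥ 128`) is proved in the tree. [cite: ChenVoutier1997, Thm 3, Thm 5, §3.2] -/
theorem simplestQuarticThueSolutions_of
    (H5 : ∀ t : ℤ, 128 ≤ t → ∀ ε ρ : ℝ, 0 < ε → ε - ε⁻¹ = (t : ℝ) / 2 → 0 < ρ → ρ ^ 2 = 1 + ε ^ 2 →
      ∀ β ∈ ({ε - ρ, (ρ - 1) / ε, -(ρ + 1) / ε} : Set ℝ), ∀ p q : ℤ, (4 / 25 : ℝ) * t < |(q : ℝ)| →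
        1 / (1133 / 100 * t * (2 / 5 : ℝ) ^ (Real.log (8 * ε) / Real.log (ε / 8)) *
          |(q : ℝ)| ^ (Real.log (8 * ε) / Real.log (ε / 8))) < |(p : ℝ) - β * q|)
    (H127 : ∀ t : ℤ, 1 ≤ t → t ≤ 127 → t ≠ 3 → ∀ x y : ℤ, 2 ≤ |x| → 2 ≤ |y| →
      (5 ≤ t → t - 1 < 5 * |x| ∧ t - 1 < 5 * |y|) →
      (simplestQuarticForm t x y = 1 ∨ simplestQuarticForm t x y = -1) →
        t = 4 ∧ (x, y) ∈ ({(-3, 2), (-2, -3), (2, 3), (3, -2)} : Set (ℤ × ℤ))) :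
    SimplestQuarticThueSolutions := by
  refine simplestQuarticThueSolutions_of_large fun t ht ht3 x y hx hy hlarge hP => ?_
  rcases le_or_gt t 127 with h127 | h128
  · exact H127 t ht h127 ht3 x y hx hy hlarge hP
  · exfalso
    have ht128 : 128 ≤ t := by omega
    obtain ⟨ε, hε, h⟩ := exists_eps (t : ℝ)
    obtain ⟨ρ, hρ, hρ2⟩ := exists_rho ε
    have hT : (128 : ℝ) ≤ (t : ℝ) := by exact_mod_cast ht128
    have hε64 : 64 < ε := eps_gt hε h hT
    have hκ3 : Real.log (8 * ε) / Real.log (ε / 8) < 3 := kappa_lt_three hε64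
    have hκ1 : 1 < Real.log (8 * ε) / Real.log (ε / 8) := one_lt_kappa (by linarith)
    refine no_large_solution_of_measure ht128 hε h hρ hρ2 (by linarith) hκ3
      (H5 t ht128 ε ρ hε h hρ hρ2) (x := x) (y := y) ?_ hP
    have := (hlarge (by omega)).2
    omega

end SimplestQuarticThue

end Literature.NumberTheory.DiophantineGeometry
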